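import Summits.AtomisticToContinuum.Crystallization.Theorems.FluxTubeKeplerFloorGivesLayered
import Summits.AtomisticToContinuum.Crystallization.Theorems.FluxTubeKeplerFluxCellKeplerSingleScale
import Summits.AtomisticToContinuum.Crystallization.Theorems.ChessboardParticlePlanesPeriodicWindowsIffCrystallization
import Summits.AtomisticToContinuum.Crystallization.Theorems.FluxTubeKeplerKeplerEnergyFloor

/-!
# Line `ScaleBlindRung` (scale ladder) — skeleton for the forward rung over `FluxTubeKepler.FloorGivesLayered`
(crux dir `FluxCellKepler`, stmt-AtomisticToContinuum-15221; fwd-rung G1 gen 5, seed g1-AtomisticToContinuum-15223)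

FLOOR (proved, `FluxTubeKeplerFloorGivesLayered.FloorGivesLayered_proof`): for every periodic `P₀`, the energy
floor `N·e(P₀) ≤ E(x)` on Lennard-Jones ground states together with the defect BUDGET — at every scale `(R,η)` some
`c > 0` prices every site whose `R`-neighbourhood is not two-way `η`-close to an admissible layered template whose
in-plane SPACING lies in the box `a ∈ [47/50, 1]` (Hägg word, Barlow registry, interlayer gaps in `[39a/50, 17a/20]`)
— forces layered windows, hence (proved `PeriodicGivenLayered`) periodic windows, along every ground-state sequence.

RUNG (`ScaleBlindRung := ScaleRung (Set.Ioi 0)`): the budget need only price the sites whose `R`-neighbourhood is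
not two-way `η`-close to a layered template of SOME spacing `a > 0` — the whole admissible family uniformly DILATED
or COMPRESSED at will (gaps in the box scaled with `a`).  A Kepler-type certificate then never has to charge a site
for the LATTICE CONSTANT of the perfect material around it; the lattice constant of the windows is selected by the
energy (equation of state).  Dial `ScaleRung I` (`I ⊆ ℝ` the set of unpriced spacings): `ScaleRung [47/50,1]` is the
floor (`scaleRung_box`, F3), antitone dial `scaleRung_anti` (harder-to-easier = shrinking `I`), on-path
`scaleRung_of_crystallization` / `ScaleBlindRung_of_Crystallization` (F4, landed iff `periodicWindows_of_crystallization`).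

WHY THE FLOOR'S PROOF STOPS: Step 1 of the seed (`eventually_exists_not_bad`) now yields good sites with
scale-dependent spacings `a_k ∈ (0, ∞)`; Step 2 (`spacing_selection`) selects ONE spacing by Bolzano–Weierstrass on
the COMPACT box `[47/50, 1]` and Step 2' (`match_dilate`) needs the ratio bounds `|1 − a/b| ≤ θ` that the box
provides — on `(0, ∞)` the spacings may degenerate (`a_k → ∞`: ever more dilute windows) and, even when they
converge, the limit spacing need not lie in the box, so `PeriodicGivenLayered` (stated on the box) has no input.
No potential-free repair exists: the uniformly dilated Barlow stack `2 • P_fcc` is scale-good at every site and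
box-good at none.  The missing input is ENERGY: the lattice constant a Lennard-Jones ground state selects.

THE LINE (three stubs, the only `sorry`s; composition `ScaleBlindRung_of` sorry-free):
* `stub_eosGap` (THE NEW INPUT, configuration-free certified lattice-sum numerics — the EQUATION OF STATE): every
  layered template with spacing OUTSIDE the box (any Hägg word, gaps in the scaled box) has window energies
  `Σ_{p∈W} e_p(S) ≥ 2(e* + g₀)·#W − C·∂W` for a uniform `g₀ > 0`, in the window-bound currency of the landed
  `LayeredHull.stub_windowBounds` (`e* = eStar`; the in-box minimiser `a* ≈ 0.9712` is interior, the edge templates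
  cost `≈ 0.010` (`a = 1`) and `≈ 0.018` (`a = 47/50`) per particle after interlayer relaxation inside the box).
* `stub_spacingFloor` (potential-free geometry, the cheap end): a scale-good site of a `δ`-separated configuration
  has spacing `a ≥ δ − 2η` (chain of template points `p₀ + k·Au` matched to one particle).
* `stub_scaleSelection` (Lennard-Jones block accounting along ground states; load-bearing analysis): given the two
  previous statements, along a ground-state sequence whose scale-blind defects are sparse at every scale the BOX
  defects are sparse too (`E(x_N) ≤ N·e* + o(N)` by `crysEnergyLimit`; blocks matched to an out-of-box template
  pay `g₀` per site by the equation of state, blocks matched to an in-box template pay `≥ 0` by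
  `card_mul_eStar_le`/(L); so out-of-box blocks are `o(N)`).
Glue (proved here): monotonicity of the predicates in `I`, `fewScaleBad_of_budget` (counting, as the seed's
`eventually_exists_not_bad` with a density `θ`), `good_of_sparse` (landed chart gluing
`FluxCellKeplerSingleScale.card_bad_le` + `LennardJonesMinimalDistance_holds`, verbatim from the sibling line
`Lines/RegistryBlindRung.lean`), `hasLayeredWindows_of_good` (Steps 2–3 of the seed, verbatim from the sibling
lines), proved `PeriodicGivenLayered`.
-/

noncomputable section

namespace Summit.AtomisticToContinuum.Crystallization.Cruxes.FluxCellKepler.ScaleLadder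

open scoped BigOperators Classical
open Filter Topology
open Literature.MathematicalPhysics.StatisticalMechanics
open Summit.AtomisticToContinuum.Crystallization.Theorems.FluxCellKeplerSingleScale
  (LayeredGood layeredGood_mono card_bad_le)
open Summit.AtomisticToContinuum.Crystallization.Theorems.ChargedEnergyGapNegative
  (eStar card_mul_eStar_le crysEnergyLimit)

local notation "E3" => EuclideanSpace ℝ (Fin 3)

/-- FLOOR(P₀): `N · e(P₀) ≤ E(x)` for every Lennard-Jones ground state (verbatim the floor's first hypothesis). -/
def Floor (P₀ : PeriodicConfiguration 3) : Prop :=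
  ∀ (N : ℕ) (x : Fin N → E3), IsGroundState lennardJones x →
    (N : ℝ) * P₀.energyPerParticle lennardJones ≤ interactionEnergy lennardJones x

/-- `I`-SCALE-GOOD SITE: some layered template (Hägg word `s`, Barlow registry, rigid motion `A`) with in-plane
spacing `a ∈ I` and interlayer gaps in the SCALED box `[39a/50, 17a/20]` matches the `R`-ball around `x i` two-way
with tolerance `η`.  `I = [47/50, 1]`: the floor's predicate `LayeredGood R η` (`scaleGood_box_iff`);
`I = (0, ∞)`: every spacing (scale-blind). -/
def ScaleGood (I : Set ℝ) (R η : ℝ) {N : ℕ} (x : Fin N → E3) (i : Fin N) : Prop :=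
  ∃ a : ℝ, a ∈ I ∧ ∃ (A : E3 →ₗᵢ[ℝ] E3) (s : ℤ → ℤ) (z : ℤ → ℝ), IsHaggSeq s ∧
    (∀ m : ℤ, 39 / 50 * a ≤ z (m + 1) - z m ∧ z (m + 1) - z m ≤ 17 / 20 * a) ∧
    let S : Set E3 := {p | ∃ m k l : ℤ, p = A (((k : ℝ) • triangularVec₁ a) + ((l : ℝ) • triangularVec₂ a) +
      ((haggLabel s m : ℝ) • barlowOffset a) + (z m • layerNormal 1))}
    (∀ p ∈ S, ‖p‖ ≤ R → ∃ j : Fin N, dist (x j - x i) p ≤ η) ∧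
    (∀ j : Fin N, ‖x j - x i‖ ≤ R → ∃ p ∈ S, dist (x j - x i) p ≤ η)

/-- SCALE-BLIND BUDGET with dial `I`: at every scale `(R,η)` some `c > 0` prices the sites that are not
`I`-scale-good against the excess energy over `N · e(P₀)` (`I = [47/50, 1]`: the floor's budget). -/
def ScaleBudget (I : Set ℝ) (P₀ : PeriodicConfiguration 3) : Prop :=
  ∀ R η : ℝ, 0 < R → 0 < η → ∃ c : ℝ, 0 < c ∧
    ∀ (N : ℕ) (x : Fin N → E3), IsGroundState lennardJones x →
      c * (Nat.card {i : Fin N // ¬ ScaleGood I R η x i} : ℝ) ≤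
        interactionEnergy lennardJones x - (N : ℝ) * P₀.energyPerParticle lennardJones

/-- Periodic windows at every scale along `x` (verbatim the conclusion of `FluxTubeKepler.PeriodicGivenLayered`). -/
def HasPeriodicWindows (x : (N : ℕ) → (Fin N → E3)) : Prop :=
  ∃ P : PeriodicConfiguration 3, ∀ R ε : ℝ, 0 < ε → ∃ᶠ N in atTop, ∃ t : E3,
    (∀ s ∈ P.points, ‖s‖ ≤ R → ∃ i : Fin N, dist (x N i + t) s ≤ ε) ∧
    (∀ i : Fin N, ‖x N i + t‖ ≤ R → ∃ s ∈ P.points, dist (x N i + t) s ≤ ε)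

/-- **The graded family.** `ScaleRung I`: FLOOR and the budget that leaves the spacings in `I` unpriced force
periodic windows along every Lennard-Jones ground-state sequence. -/
def ScaleRung (I : Set ℝ) : Prop :=
  ∀ P₀ : PeriodicConfiguration 3, Floor P₀ → ScaleBudget I P₀ →
    ∀ x : (N : ℕ) → (Fin N → E3), (∀ N, IsGroundState lennardJones (x N)) → HasPeriodicWindows x

/-- **Deciding rung.** The budget need not price the LATTICE CONSTANT at all: pricing only the sites whose
`R`-neighbourhood is not `η`-close to SOME uniformly dilated or compressed admissible layered template (any spacing
`a > 0`, gaps in the scaled box) suffices — the spacing of the windows is then selected by the energy. -/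
def ScaleBlindRung : Prop := ScaleRung (Set.Ioi 0)

/-! ## Predicate bookkeeping -/

theorem scaleGood_mono {I I' : Set ℝ} (hI : I ⊆ I') {R η : ℝ} {N : ℕ} (x : Fin N → E3) (i : Fin N) :
    ScaleGood I R η x i → ScaleGood I' R η x i := by
  rintro ⟨a, ha, A, s, z, hs, hz, h₁, h₂⟩
  exact ⟨a, hI ha, A, s, z, hs, hz, h₁, h₂⟩

theorem layeredGood_of_scaleGood_box {R η : ℝ} {N : ℕ} (x : Fin N → E3) (i : Fin N) :
    ScaleGood (Set.Icc (47 / 50) 1) R η x i → LayeredGood R η x i := by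
  rintro ⟨a, ⟨ha₁, ha₂⟩, A, s, z, hs, hz, h₁, h₂⟩
  exact ⟨a, ha₁, ha₂, A, s, z, hs, hz, h₁, h₂⟩

theorem scaleGood_box_of_layeredGood {R η : ℝ} {N : ℕ} (x : Fin N → E3) (i : Fin N) :
    LayeredGood R η x i → ScaleGood (Set.Icc (47 / 50) 1) R η x i := by
  rintro ⟨a, ha₁, ha₂, A, s, z, hs, hz, h₁, h₂⟩
  exact ⟨a, ⟨ha₁, ha₂⟩, A, s, z, hs, hz, h₁, h₂⟩

/-- The floor's predicate is the member `I = [47/50, 1]` of the family. -/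
theorem scaleGood_box_iff {R η : ℝ} {N : ℕ} (x : Fin N → E3) (i : Fin N) :
    ScaleGood (Set.Icc (47 / 50) 1) R η x i ↔ LayeredGood R η x i :=
  ⟨layeredGood_of_scaleGood_box x i, scaleGood_box_of_layeredGood x i⟩

/-- `ScaleGood I` is antitone in the radius and monotone in the tolerance. [folklore] -/
theorem scaleGood_mono_scale {I : Set ℝ} {R R' η η' : ℝ} (hR : R ≤ R') (hη : η' ≤ η) {N : ℕ}
    (x : Fin N → E3) (i : Fin N) : ScaleGood I R' η' x i → ScaleGood I R η x i := by
  rintro ⟨a, ha, A, s, z, hs, hz, h₁, h₂⟩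
  refine ⟨a, ha, A, s, z, hs, hz, ?_, ?_⟩
  · intro p hp hpR
    obtain ⟨j, hj⟩ := h₁ p hp (hpR.trans hR)
    exact ⟨j, hj.trans hη⟩
  · intro j hj
    obtain ⟨p, hp, hjp⟩ := h₂ j (hj.trans hR)
    exact ⟨p, hp, hjp.trans hη⟩

/-- The budget is monotone in the dial: a budget pricing the larger bad set prices the smaller one. -/
theorem scaleBudget_mono {I I' : Set ℝ} (hI : I ⊆ I') (P₀ : PeriodicConfiguration 3) :
    ScaleBudget I P₀ → ScaleBudget I' P₀ := by
  intro hB R η hR hη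
  obtain ⟨c, hc, hcB⟩ := hB R η hR hη
  refine ⟨c, hc, fun N x hx => le_trans ?_ (hcB N x hx)⟩
  have hle : Nat.card {i : Fin N // ¬ ScaleGood I' R η x i} ≤ Nat.card {i : Fin N // ¬ ScaleGood I R η x i} := by
    rw [Nat.card_eq_fintype_card, Nat.card_eq_fintype_card]
    exact Fintype.card_subtype_mono _ _ fun i hi hg => hi (scaleGood_mono hI x i hg)
  exact mul_le_mul_of_nonneg_left (by exact_mod_cast hle) hc.le

/-! ## F3 — the family specialises to the proved floor -/

/-- `ScaleRung [47/50, 1]` is the floor: the seed theorem followed by the proved `PeriodicGivenLayered`. -/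
theorem scaleRung_box : ScaleRung (Set.Icc (47 / 50) 1) := by
  intro P₀ hF hB x hx
  refine Theses.FluxTubeKepler.PeriodicGivenLayered_holds x hx
    (Theorems.FluxTubeKeplerFloorGivesLayered.FloorGivesLayered_proof P₀ hF ?_ x hx)
  intro R η hR hη
  obtain ⟨c, hc, hcB⟩ := hB R η hR hη
  refine ⟨c, hc, fun N y hy => ?_⟩
  show c * (Nat.card {i : Fin N // ¬ LayeredGood R η y i} : ℝ) ≤ _
  refine le_trans ?_ (hcB N y hy)
  have hle : Nat.card {i : Fin N // ¬ LayeredGood R η y i} ≤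
      Nat.card {i : Fin N // ¬ ScaleGood (Set.Icc (47 / 50) 1) R η y i} := by
    rw [Nat.card_eq_fintype_card, Nat.card_eq_fintype_card]
    exact Fintype.card_subtype_mono _ _ fun i hi hg => hi (layeredGood_of_scaleGood_box y i hg)
  exact mul_le_mul_of_nonneg_left (by exact_mod_cast hle) hc.le

/-! ## Dial monotonicity (harder-to-easier = shrinking the unpriced set `I`) -/

theorem scaleRung_anti {I I' : Set ℝ} (hI : I ⊆ I') : ScaleRung I' → ScaleRung I :=
  fun H P₀ hF hB x hx => H P₀ hF (scaleBudget_mono hI P₀ hB) x hx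

theorem box_subset_Ioi : Set.Icc (47 / 50 : ℝ) 1 ⊆ Set.Ioi 0 := fun a ha => by
  simp only [Set.mem_Icc, Set.mem_Ioi] at ha ⊢
  linarith [ha.1]

/-- The deciding rung gives every member below it, in particular the floor (informational `specialises`). -/
theorem scaleRung_of_scaleBlindRung {I : Set ℝ} (hI : I ⊆ Set.Ioi 0) (h : ScaleBlindRung) : ScaleRung I :=
  scaleRung_anti hI h

theorem scaleRung_box_of_scaleBlindRung (h : ScaleBlindRung) : ScaleRung (Set.Icc (47 / 50) 1) :=
  scaleRung_of_scaleBlindRung box_subset_Ioi h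

/-! ## F4 — on-path lemmas: the sub-problem implies every member -/

theorem scaleRung_of_crystallization (I : Set ℝ) (h : _root_.Crystallization) : ScaleRung I :=
  fun _ _ _ x hx =>
    Theorems.ChessboardParticlePlanesPeriodicWindowsIffCrystallization.periodicWindows_of_crystallization h x hx

@[aesop safe apply]
theorem ScaleBlindRung_of_Crystallization (h : _root_.Crystallization) : ScaleBlindRung :=
  scaleRung_of_crystallization _ h

/-! ## How the rung relieves the parent crux `FluxCellKepler` (documentation, sorry-free) -/

/-- The floor-and-`I`-blind-budget package (what a Kepler-type certificate that never has to charge a site for a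
lattice constant in `I` delivers). -/
def ScaleKeplerFloor (I : Set ℝ) : Prop := ∃ P₀ : PeriodicConfiguration 3, Floor P₀ ∧ ScaleBudget I P₀

theorem scaleKeplerFloor_mono {I I' : Set ℝ} (hI : I ⊆ I') : ScaleKeplerFloor I → ScaleKeplerFloor I' := by
  rintro ⟨P₀, hF, hB⟩
  exact ⟨P₀, hF, scaleBudget_mono hI P₀ hB⟩

theorem crystallization_of_scaleRung {I : Set ℝ} (h : ScaleRung I) (hK : ScaleKeplerFloor I) :
    _root_.Crystallization := by
  obtain ⟨P₀, hF, hB⟩ := hK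
  exact Theorems.ChessboardParticlePlanesPeriodicWindowsIffCrystallization.crystallization_of_periodicWindows
    (fun x hx => h P₀ hF hB x hx)

/-- The parent crux gives the package on the box (proved `KeplerEnergyFloor` + minimal distance), hence on every
`I ⊇ [47/50, 1]` — in particular the scale-blind package, so `ScaleBlindRung` + the parent crux decide the
sub-problem (`crystallization_of_scaleRung`). -/
theorem scaleKeplerFloor_box_of_fluxCellKepler (hK : Theses.FluxTubeKepler.FluxCellKepler) :
    ScaleKeplerFloor (Set.Icc (47 / 50) 1) := by
  obtain ⟨P₀, hF, hB⟩ := Theorems.keplerEnergyFloor_proof hK LennardJonesMinimalDistance_holds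
  refine ⟨P₀, hF, fun R η hR hη => ?_⟩
  obtain ⟨c, hc, hcB⟩ := hB R η hR hη
  refine ⟨c, hc, fun N y hy => ?_⟩
  have hcB' : c * (Nat.card {i : Fin N // ¬ LayeredGood R η y i} : ℝ) ≤
      interactionEnergy lennardJones y - (N : ℝ) * P₀.energyPerParticle lennardJones := hcB N y hy
  refine le_trans ?_ hcB'
  have hle : Nat.card {i : Fin N // ¬ ScaleGood (Set.Icc (47 / 50) 1) R η y i} ≤
      Nat.card {i : Fin N // ¬ LayeredGood R η y i} := by
    rw [Nat.card_eq_fintype_card, Nat.card_eq_fintype_card]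
    exact Fintype.card_subtype_mono _ _ fun i hi hg => hi (scaleGood_box_of_layeredGood y i hg)
  exact mul_le_mul_of_nonneg_left (by exact_mod_cast hle) hc.le

theorem crystallization_of_scaleBlindRung_of_fluxCellKepler (h : ScaleBlindRung)
    (hK : Theses.FluxTubeKepler.FluxCellKepler) : _root_.Crystallization :=
  crystallization_of_scaleRung h (scaleKeplerFloor_mono box_subset_Ioi (scaleKeplerFloor_box_of_fluxCellKepler hK))


/-! ## The line: lattice-constant selection from energy (equation of state)

Currency.  For a set `S ⊆ ℝ³` and `p ∈ S` the SITE ENERGY is `e_p(S) = Σ'_{q ∈ S, q ≠ p} V_LJ(|p − q|)` and the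
boundary weight of a finite window `W ⊆ S` is `∂W = Σ_{p∈W} (1 + dist(p, S∖W))⁻³` — exactly the currency of the
landed window bounds `LayeredHull.stub_windowBounds` ((U): `Σ_W e_p ≤ 2E(#W) + C∂W` in the hull of ground states;
(L): `Σ_W e_p ≥ 2E(#W) − C∂W` for separated sets), with `N·e* ≤ E(N)` (`card_mul_eStar_le`). -/

/-- SCALE-BLIND DEFECTS ARE SPARSE along `x`: at every scale `(R, η)` and every density `θ > 0`, eventually at most
`θN` sites are not `(0,∞)`-scale-good (what FLOOR + the scale-blind budget deliver, `fewScaleBad_of_budget`). -/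
def FewScaleBad (x : (N : ℕ) → (Fin N → E3)) : Prop :=
  ∀ R η θ : ℝ, 0 < R → 0 < η → 0 < θ →
    ∀ᶠ N in atTop, (Nat.card {i : Fin N // ¬ ScaleGood (Set.Ioi 0) R η (x N) i} : ℝ) ≤ θ * N

/-! ### The stub statements as named propositions (verbatim; later stubs take earlier ones as hypotheses) -/

/-- Statement of `stub_eosGap` (verbatim; see there). [conjecture] -/
def Sig.stub_eosGap : Prop :=
    ∃ g₀ C : ℝ, 0 < g₀ ∧ ∀ a : ℝ, 0 < a → (a < 47 / 50 ∨ 1 < a) →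
      ∀ (A : E3 →ₗᵢ[ℝ] E3) (s : ℤ → ℤ) (z : ℤ → ℝ), IsHaggSeq s →
        (∀ m : ℤ, 39 / 50 * a ≤ z (m + 1) - z m ∧ z (m + 1) - z m ≤ 17 / 20 * a) →
        let S : Set E3 := {p | ∃ m k l : ℤ, p = A (((k : ℝ) • triangularVec₁ a) + ((l : ℝ) • triangularVec₂ a) +
          ((haggLabel s m : ℝ) • barlowOffset a) + (z m • layerNormal 1))}
        ∀ W : Finset E3, (↑W : Set E3) ⊆ S →
          2 * (eStar + g₀) * (W.card : ℝ) - C * ∑ p ∈ W, (1 + Metric.infDist p (S \ (↑W : Set E3)))⁻¹ ^ 3 ≤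
            ∑ p ∈ W, (∑' q : {q : E3 // q ∈ S ∧ q ≠ p}, lennardJones (dist p (q : E3)))

/-- Statement of `stub_spacingFloor` (verbatim; see there). [folklore] -/
def Sig.stub_spacingFloor : Prop :=
    ∀ δ : ℝ, 0 < δ → ∀ (N : ℕ) (x : Fin N → E3), (∀ i j : Fin N, i ≠ j → δ ≤ dist (x i) (x j)) →
      ∀ R η : ℝ, δ ≤ R → 0 < η → 2 * η < δ →
        ∀ i : Fin N, ScaleGood (Set.Ioi 0) R η x i → ScaleGood (Set.Ici (δ - 2 * η)) R η x i

/-- Statement of `stub_scaleSelection` (verbatim; see there). [conjecture] -/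
def Sig.stub_scaleSelection : Prop := Sig.stub_eosGap → Sig.stub_spacingFloor →
    ∀ x : (N : ℕ) → (Fin N → E3), (∀ N, IsGroundState lennardJones (x N)) → FewScaleBad x →
      ∀ η θ : ℝ, 0 < η → 0 < θ →
        ∀ᶠ N in atTop, (Nat.card {i : Fin N // ¬ LayeredGood 2 η (x N) i} : ℝ) ≤ θ * N

/-! ### The declared stubs (the only `sorry`s of the file) -/

/-- **Stub 1 — equation-of-state gap of the layered Lennard-Jones lattice sums (THE NEW INPUT; load-bearing;
configuration-free).**  There are `g₀ > 0` and `C` such that for every spacing `a > 0` OUTSIDE the box `[47/50, 1]`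
and every layered template `S` of spacing `a` (any rigid motion `A`, any Hägg word `s`, interlayer gaps in the scaled
box `[39a/50, 17a/20]`), every finite window `W ⊆ S` satisfies
`Σ_{p∈W} e_p(S) ≥ 2(e* + g₀)·#W − C·Σ_{p∈W}(1 + dist(p, S∖W))⁻³`.  Intended proof (`V(r) = r⁻¹²/12 − r⁻⁶/6`,
minimum `−1/12` at `r = 1`): (i) `e* ≤ e(Q₀) ≤ −0.7175` for an explicit Barlow stack `Q₀` of spacing `≈ 0.9712`
(landed certificates `ThreeConeCertificate….eStar_le : eStar ≤ −7175/10000`; only `e* ≤ …` is needed, so the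
unknown value of `e*` never enters); (ii) the energy per site of a layered template is the layer cake
`½(e_2D(a) + Σ_{m'≠m} Φ(a; z_{m'} − z_m, registry))` averaged over the layers met by `W`, up to the boundary weight
(interlayer couplings decay like `H⁻⁴`, in-plane tails like `r⁻⁶`); (iii) certified interval evaluation of
`min` over the gap box of the layer cake for `a ∈ (0, 47/50) ∪ (1, ∞)`: `a ≤ 9/10` or `a ≥ 21/20` cost `> 0.05`
(nearest-neighbour strain alone), the edges cost `≈ 0.018` (`a = 47/50`: in-plane bonds compressed `3.2 %`) and
`≈ 0.010` (`a = 1`: tail dilated, interlayer gap relaxes to the box edge `39a/50`) per site above `−0.7175`, with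
adjacent-pair over-relaxation of non-uniform gap sequences `≤ 0.004`; `a → ∞` (dilute) and `a → 0` (overlapping
cores) are trivial.  May fail through the `≈ 1 %` margin at the edge `a = 1⁺` with the most favourable NON-UNIFORM
gap sequence (the window average, not each site, must clear `e* + g₀` — hence the `−C∂W` slack excusing thin
windows), or if `e*` were attained far below the Barlow value (impossible to the stated precision only given the
certified `e* ≥ …` lower bounds of the tree, which this stub does not need: a lower `e*` only helps). [conjecture] -/
theorem stub_eosGap :
    ∃ g₀ C : ℝ, 0 < g₀ ∧ ∀ a : ℝ, 0 < a → (a < 47 / 50 ∨ 1 < a) →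
      ∀ (A : E3 →ₗᵢ[ℝ] E3) (s : ℤ → ℤ) (z : ℤ → ℝ), IsHaggSeq s →
        (∀ m : ℤ, 39 / 50 * a ≤ z (m + 1) - z m ∧ z (m + 1) - z m ≤ 17 / 20 * a) →
        let S : Set E3 := {p | ∃ m k l : ℤ, p = A (((k : ℝ) • triangularVec₁ a) + ((l : ℝ) • triangularVec₂ a) +
          ((haggLabel s m : ℝ) • barlowOffset a) + (z m • layerNormal 1))}
        ∀ W : Finset E3, (↑W : Set E3) ⊆ S →
          2 * (eStar + g₀) * (W.card : ℝ) - C * ∑ p ∈ W, (1 + Metric.infDist p (S \ (↑W : Set E3)))⁻¹ ^ 3 ≤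
            ∑ p ∈ W, (∑' q : {q : E3 // q ∈ S ∧ q ≠ p}, lennardJones (dist p (q : E3))) := by
  sorry

/-- **Stub 2 — spacing floor (potential-free geometry; the cheap end of the line).**  In a `δ`-separated
configuration, a `(0,∞)`-scale-good site at scale `(R, η)` with `δ ≤ R`, `2η < δ` is `[δ − 2η, ∞)`-scale-good (same
template).  Intended proof: if `a < δ − 2η`, let `p₀ ∈ S` be the template point within `η` of the centre
`0 = x i − x i` and `p_k := p₀ + k • A (triangularVec₁ a) ∈ S` (`‖triangularVec₁ a‖ = a`); consecutive `p_k` are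
`a` apart, so while `‖p_k‖ ≤ R` their matched particles are `≤ a + 2η < δ` apart, hence equal, hence all equal to
`i` (the particle matched to `p₀`, `2η < δ`); but the first `k` with `‖p_k‖ > η` still has `‖p_k‖ ≤ η + a < δ − η ≤ R`
and is matched to `i` at distance `‖p_k‖ > η` — contradiction.  May fail only through an indexing slip
(membership of `p_k` in `S`: `k ↦ k + 1` in the first lattice coordinate). [folklore] -/
theorem stub_spacingFloor :
    ∀ δ : ℝ, 0 < δ → ∀ (N : ℕ) (x : Fin N → E3), (∀ i j : Fin N, i ≠ j → δ ≤ dist (x i) (x j)) →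
      ∀ R η : ℝ, δ ≤ R → 0 < η → 2 * η < δ →
        ∀ i : Fin N, ScaleGood (Set.Ioi 0) R η x i → ScaleGood (Set.Ici (δ - 2 * η)) R η x i := by
  sorry

/-- **Stub 3 — lattice-constant selection along ground states (Lennard-Jones block accounting; load-bearing).**
Given the equation-of-state gap and the spacing floor: along every sequence of Lennard-Jones ground states whose
scale-blind defects are sparse at every scale (`FewScaleBad`), the BOX defects are sparse too — for every `η, θ > 0`,
eventually at most `θN` sites are not two-way `(2, η)`-layered-good with spacing in `[47/50, 1]`.  Intended proof:
fix a large accounting scale `(R', η')` (`R' ≥ 2`, `η' ≤ min η (δ/4)`) and a block side `B` with `R' ≥ 4B`; by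
`FewScaleBad`, eventually all but `θ'N` sites are scale-good at `(R', η')`, with spacing `a ≥ δ/2` (Stub 2,
`LennardJonesMinimalDistance_holds`), so on each block containing a good site the particles are in BIJECTION with the
template points (`η' < δ/4`) and `Σ_{j∈block} ½·siteE_j(x_N) ≥ ½ Σ_{p∈W} e_p(S) − #block·ω(η', R')`
(`W` = template points of the block, Lipschitz bound of `V` on `[δ/2, ∞)`, tails `R'⁻³`; `ω → 0`); by Stub 1 an
OUT-OF-BOX block pays `≥ #block·(e* + g₀) − C·B²`, an in-box block pays `≥ #block·e* − C·B²` ((L)-type bound: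
periodise the window, `card_mul_eStar_le`), a block without good site holds only `θ'`-budgeted sites with
`½·siteE ≥ −C₀`; summing and comparing with `E(x_N) ≤ N·e* + o(N)` (`crysEnergyLimit`, `IsGroundState`):
`g₀·#{sites in out-of-box blocks} ≤ o(N) + N·(ω + C/B + C θ')`, which is `≤ θN/2` for `R'`, `1/η'`, `B`, `1/θ'`
large; the remaining `≥ (1 − θ)N` sites are `(R' − 2B, η')`-good for an IN-BOX template, i.e. `LayeredGood`, and
`LayeredGood` is antitone in the radius / monotone in the tolerance (`layeredGood_mono`).  May fail through the
bookkeeping of blocks meeting two differently-scaled templates (overlaps are consistent up to `2η'` on `R'/2`-balls,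
so block-wise accounting never mixes them) or if `ω(η', R')` were not uniform in the spacing `a ≥ δ/2` (it is:
the Lipschitz constant of `V` on `[δ/4, ∞)` and the tail `Σ_{|q|>R'} |q|⁻⁶` over an `a`-separated set are uniform).
[conjecture] -/
theorem stub_scaleSelection : Sig.stub_eosGap → Sig.stub_spacingFloor →
    ∀ x : (N : ℕ) → (Fin N → E3), (∀ N, IsGroundState lennardJones (x N)) → FewScaleBad x →
      ∀ η θ : ℝ, 0 < η → 0 < θ →
        ∀ᶠ N in atTop, (Nat.card {i : Fin N // ¬ LayeredGood 2 η (x N) i} : ℝ) ≤ θ * N := by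
  sorry

/-! ### Sorry-free glue -/

/-- **Counting** (the seed's `eventually_exists_not_bad` with a density): under FLOOR(P₀) (`e(P₀) = e*`,
`floor_iff_eq_eStar`) and the scale-blind budget, `c·#bad ≤ E(N) − N·e*` and `E(N)/N → e*` (`crysEnergyLimit`) give,
for every `θ > 0`, eventually `#bad ≤ θN`. [folklore] -/
theorem fewScaleBad_of_budget (P₀ : PeriodicConfiguration 3) (hF : Floor P₀) (hB : ScaleBudget (Set.Ioi 0) P₀)
    (x : (N : ℕ) → (Fin N → E3)) (hx : ∀ N, IsGroundState lennardJones (x N)) : FewScaleBad x := by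
  intro R η θ hR hη hθ
  obtain ⟨c, hc, hcB⟩ := hB R η hR hη
  have heq := (Theorems.FluxTubeKeplerFloorGivesLayered.floor_iff_eq_eStar P₀).1 hF
  have hlim := crysEnergyLimit
  have hlt : (⨅ Q : PeriodicConfiguration 3, Q.energyPerParticle lennardJones) < eStar + c * θ := by
    change eStar < eStar + c * θ
    nlinarith
  have hev : ∀ᶠ N : ℕ in atTop, groundStateEnergy lennardJones 3 N / N < eStar + c * θ :=
    hlim.eventually (gt_mem_nhds hlt)
  filter_upwards [hev, Filter.eventually_gt_atTop 0] with N hN hNpos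
  have h1 := hcB N (x N) (hx N)
  rw [heq, (hx N).2] at h1
  have hNr : (0 : ℝ) < N := by exact_mod_cast hNpos
  have h2 : groundStateEnergy lennardJones 3 N < (eStar + c * θ) * N := by
    rwa [div_lt_iff₀ hNr] at hN
  have h3 : c * (Nat.card {i : Fin N // ¬ ScaleGood (Set.Ioi 0) R η (x N) i} : ℝ) < c * (θ * N) := by
    nlinarith
  exact (lt_of_mul_lt_mul_left h3 hc.le).le

/-- (Verbatim from the sibling line `Lines/RegistryBlindRung.lean` (RegistryLadder).)  **Sparse radius-`2` box
defects ⇒ good sites at every scale, frequently** (landed chart gluing `FluxCellKeplerSingleScale.card_bad_le` at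
`R₀ = 2`, `δ`-separation of ground states `LennardJonesMinimalDistance_holds`, and counting). [folklore] -/
theorem good_of_sparse (x : (N : ℕ) → (Fin N → E3)) (hx : ∀ N, IsGroundState lennardJones (x N))
    (hsp : ∀ η θ : ℝ, 0 < η → 0 < θ →
      ∀ᶠ N in atTop, (Nat.card {i : Fin N // ¬ LayeredGood 2 η (x N) i} : ℝ) ≤ θ * N) :
    ∀ R η : ℝ, 0 < R → 0 < η → ∃ᶠ N in atTop, ∃ i : Fin N, LayeredGood R η (x N) i := by
  intro R η hR hη
  obtain ⟨δ, hδ, hsep⟩ := LennardJonesMinimalDistance_holds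
  obtain ⟨η', hη', M, hM, hcard⟩ := card_bad_le (le_refl (2 : ℝ)) hδ R η hη
  have hθ : (0 : ℝ) < 1 / (2 * M) := by positivity
  have hev := (hsp η' (1 / (2 * M)) hη' hθ).and (eventually_ge_atTop 1)
  refine hev.frequently.mono fun N hN => ?_
  obtain ⟨hNsp, hN1⟩ := hN
  by_contra hno
  have hno' : ∀ i : Fin N, ¬ LayeredGood R η (x N) i := fun i hi => hno ⟨i, hi⟩
  have hall : (N : ℝ) ≤ Nat.card {i : Fin N // ¬ LayeredGood R η (x N) i} := by
    rw [Nat.card_eq_fintype_card, Fintype.card_subtype]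
    have : (Finset.univ.filter fun i : Fin N => ¬ LayeredGood R η (x N) i) = Finset.univ :=
      Finset.filter_true_of_mem fun i _ => hno' i
    rw [this, Finset.card_univ, Fintype.card_fin]
  have h1 := hcard N (x N) (hsep N (x N) (hx N))
  have hN1' : (1 : ℝ) ≤ N := by exact_mod_cast hN1
  have hchain : (N : ℝ) ≤ M * (1 / (2 * M) * N) := hall.trans (h1.trans (mul_le_mul_of_nonneg_left hNsp hM.le))
  have hMM : M * (1 / (2 * M) * N) = N / 2 := by field_simp
  rw [hMM] at hchain
  linarith

open Summit.AtomisticToContinuum.Crystallization.Theorems.FluxTubeKeplerFloorGivesLayered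
  (spacing_selection match_dilate layered_pt_scale) in
/-- (Verbatim from the sibling lines `Lines/PosTolRung.lean`, `Lines/VacancyBlindRung.lean`,
`Lines/RegistryBlindRung.lean`.)  Steps 2–3 of the seed, isolated: good sites at every scale (with scale-dependent
spacings IN THE BOX) give the layered-windows hypothesis of `FluxTubeKepler.PeriodicGivenLayered` (one spacing by
`spacing_selection` — Bolzano–Weierstrass on the compact box, transfer by dilation `match_dilate` +
`layered_pt_scale`, translation `t := −x N i`). [folklore] -/
theorem hasLayeredWindows_of_good (x : (N : ℕ) → (Fin N → E3))
    (hgood : ∀ R η : ℝ, 0 < R → 0 < η → ∃ᶠ N in atTop, ∃ i : Fin N, LayeredGood R η (x N) i) :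
    ∃ a : ℝ, 47 / 50 ≤ a ∧ a ≤ 1 ∧ ∀ R ε : ℝ, 0 < ε → ∃ᶠ N in Filter.atTop,
      ∃ (A : E3 →ₗᵢ[ℝ] E3) (t : E3) (s : ℤ → ℤ) (z : ℤ → ℝ), IsHaggSeq s ∧
      (∀ m : ℤ, 39 / 50 * a ≤ z (m + 1) - z m ∧ z (m + 1) - z m ≤ 17 / 20 * a) ∧
      let S : Set E3 := {p | ∃ m i j : ℤ, p = A (((i : ℝ) • triangularVec₁ a) +
        ((j : ℝ) • triangularVec₂ a) + ((haggLabel s m : ℝ) • barlowOffset a) + (z m • layerNormal 1))};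
      (∀ p ∈ S, ‖p‖ ≤ R → ∃ i : Fin N, dist (x N i + t) p ≤ ε) ∧
      (∀ i : Fin N, ‖x N i + t‖ ≤ R → ∃ p ∈ S, dist (x N i + t) p ≤ ε) := by
  -- Step 2: one spacing for all scales, the transfer being dilation of the whole layered datum
  have hgood' : ∀ R η : ℝ, 0 < R → 0 < η → ∃ᶠ N in atTop, ∃ i : Fin N, ∃ a : ℝ, 47 / 50 ≤ a ∧ a ≤ 1 ∧
      ∃ (A : E3 →ₗᵢ[ℝ] E3) (s : ℤ → ℤ) (z : ℤ → ℝ), IsHaggSeq s ∧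
        (∀ m : ℤ, 39 / 50 * a ≤ z (m + 1) - z m ∧ z (m + 1) - z m ≤ 17 / 20 * a) ∧
        let S : Set E3 := {p | ∃ m k l : ℤ, p = A (((k : ℝ) • triangularVec₁ a) +
          ((l : ℝ) • triangularVec₂ a) + ((haggLabel s m : ℝ) • barlowOffset a) + (z m • layerNormal 1))};
        (∀ p ∈ S, ‖p‖ ≤ R → ∃ j : Fin N, dist (x N j - x N i) p ≤ η) ∧
        (∀ j : Fin N, ‖x N j - x N i‖ ≤ R → ∃ p ∈ S, dist (x N j - x N i) p ≤ η) := hgood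
  obtain ⟨a, ha1, ha2, hwin⟩ := spacing_selection hgood' fun R ε hR hε => by
    obtain ⟨η₁, hη₁0, hη₁ε, hη₁1⟩ : ∃ η₁ : ℝ, 0 < η₁ ∧ η₁ ≤ ε ∧ η₁ ≤ 1 :=
      ⟨min ε 1, lt_min hε one_pos, min_le_left _ _, min_le_right _ _⟩
    have hR1 : 0 < R + 1 := by linarith
    obtain ⟨θ, hθ0, hθR⟩ : ∃ θ : ℝ, 0 < θ ∧ θ * (R + 1) = η₁ / 2 :=
      ⟨η₁ / 2 / (R + 1), by positivity, by field_simp⟩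
    refine ⟨47 / 50 * θ, by positivity, R + 1, η₁ / 2, by positivity, ?_⟩
    intro a b R' η' ha hb hab hRR' hη' N i hG
    obtain ⟨A, s, z, hs, hbox, hM₁, hM₂⟩ := hG
    have ha0 : 0 < a := by linarith
    have hb0 : 0 < b := by linarith
    obtain ⟨ρ, hρ0, hρb⟩ : ∃ ρ : ℝ, 0 < ρ ∧ ρ * b = a :=
      ⟨a / b, div_pos ha0 hb0, div_mul_cancel₀ a hb0.ne'⟩
    have habs : |b - a| < 47 / 50 * θ := hab
    have h1ρ : |1 - ρ| ≤ θ := by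
      have e1 : 1 - ρ = (b - a) / b := by rw [← hρb]; field_simp
      rw [e1, abs_div, abs_of_pos hb0, div_le_iff₀ hb0]
      nlinarith [abs_nonneg (b - a)]
    have h1ρ' : |ρ⁻¹ - 1| ≤ θ := by
      have e1 : ρ⁻¹ - 1 = (b - a) / a := by rw [← hρb]; field_simp
      rw [e1, abs_div, abs_of_pos ha0, div_le_iff₀ ha0]
      nlinarith [abs_nonneg (b - a)]
    refine ⟨A, s, fun m => ρ * z m, hs, fun m => ?_, ?_⟩
    · obtain ⟨hl, hu⟩ := hbox m
      have hl' := mul_le_mul_of_nonneg_left hl hρ0.le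
      have hu' := mul_le_mul_of_nonneg_left hu hρ0.le
      constructor
      · calc 39 / 50 * a = ρ * (39 / 50 * b) := by rw [← hρb]; ring
          _ ≤ ρ * (z (m + 1) - z m) := hl'
          _ = ρ * z (m + 1) - ρ * z m := by ring
      · calc ρ * z (m + 1) - ρ * z m = ρ * (z (m + 1) - z m) := by ring
          _ ≤ ρ * (17 / 20 * b) := hu'
          _ = 17 / 20 * a := by rw [← hρb]; ring
    · have hscale : ∀ m k l : ℤ, A (((k : ℝ) • triangularVec₁ a) + ((l : ℝ) • triangularVec₂ a) +
          ((haggLabel s m : ℝ) • barlowOffset a) + ((ρ * z m) • layerNormal 1)) =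
          ρ • A (((k : ℝ) • triangularVec₁ b) + ((l : ℝ) • triangularVec₂ b) +
          ((haggLabel s m : ℝ) • barlowOffset b) + (z m • layerNormal 1)) := by
        intro m k l
        rw [← hρb]
        exact layered_pt_scale A ρ b s z m k l
      dsimp only
      refine match_dilate (fun j => x N j - x N i) _ _ hθ0 hθR hη₁ε hη₁1 hρ0 h1ρ h1ρ' hRR' hη'
        ?_ ?_ hM₁ hM₂
      · rintro p ⟨m, k, l, rfl⟩
        exact ⟨m, k, l, (hscale m k l).symm⟩
      · rintro p' ⟨m, k, l, rfl⟩
        exact ⟨_, ⟨m, k, l, rfl⟩, hscale m k l⟩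
  -- Step 3: read the fixed-spacing good site at radius `max R 1` and translate by `t := -x N i`
  refine ⟨a, ha1, ha2, fun R ε hε => ?_⟩
  have hR' : 0 < max R 1 := lt_max_of_lt_right one_pos
  refine (hwin (max R 1) ε hR' hε).mono fun N hN => ?_
  obtain ⟨i, hi⟩ := hN
  obtain ⟨A, s, z, hs, hbox, hM₁, hM₂⟩ := hi
  refine ⟨A, -x N i, s, z, hs, hbox, ?_⟩
  have hsub : ∀ j : Fin N, x N j + -x N i = x N j - x N i := fun j =>
    (sub_eq_add_neg (x N j) (x N i)).symm
  intro S
  refine ⟨fun p hp hpR => ?_, fun j hj => ?_⟩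
  · obtain ⟨j, hj⟩ := hM₁ p hp (hpR.trans (le_max_left R 1))
    exact ⟨j, by rw [hsub j]; exact hj⟩
  · rw [hsub j] at hj ⊢
    exact hM₂ j (hj.trans (le_max_left R 1))

/-! ### The skeleton theorem: the rung BY NAME from the three stub statements (sorry-free) -/

/-- **Assembly.** `stub_eosGap → stub_spacingFloor → stub_scaleSelection → ScaleBlindRung`: under FLOOR and the
scale-blind budget the scale-blind defects are sparse at every scale (`fewScaleBad_of_budget`); stubs 1+2+3 make
the radius-`2` box defects sparse along the sequence; the landed chart gluing turns sparsity into box-good sites at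
every scale (`good_of_sparse`), hence layered windows (`hasLayeredWindows_of_good`) and periodic windows (proved
`PeriodicGivenLayered`). -/
theorem ScaleBlindRung_of (h₁ : Sig.stub_eosGap) (h₂ : Sig.stub_spacingFloor) (h₃ : Sig.stub_scaleSelection) :
    ScaleBlindRung := by
  intro P₀ hF hB x hx
  have hsp := h₃ h₁ h₂ x hx (fewScaleBad_of_budget P₀ hF hB x hx)
  have hgood := good_of_sparse x hx hsp
  exact Theses.FluxTubeKepler.PeriodicGivenLayered_holds x hx (hasLayeredWindows_of_good x hgood)

/-- **The closed skeleton instance**: the rung by name from the three declared stubs (the only `sorry`s of this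
file enter here). [conjecture] -/
theorem ScaleBlindRung_skeleton : ScaleBlindRung :=
  ScaleBlindRung_of stub_eosGap stub_spacingFloor stub_scaleSelection

end Summit.AtomisticToContinuum.Crystallization.Cruxes.FluxCellKepler.ScaleLadder

end
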